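import Summits.Ventures.CertifiedManyBodySolver.Downfold.TppSeamFilling
import Literature.MathematicalPhysics.QuantumLattice.PeriodicLayeredLatticeEnergyTransport
import HarnessLib

/-!
# The INTERLAYER seam: S2's certified 2D `t–t'` words (object E/M window at filling `n`) become words
# about the three-dimensional layered one-band crystal with interlayer hopping `tperp/t`

Venture CertifiedManyBodySolver, stage S1 → S2 seam (cell `pub/hubbard-downfold` box schema, coordinate
`tperpOverT`); written by hubbard-box-p1 (cell `pub/hubbard-fast`, S2 «families of models / interlayer
coupling») at the request of hubbard-downfold-lead (hubbard-fast INBOX 2026-08-27T05:07:04Z: «a typed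
`HoldsOn` adapter with an interlayer entry is WANTED … floor inflation `2·Σ_b|t_z,b|` on the object E/M
window words, caps unchanged»). Namespace `Summit.Ventures.CertifiedManyBodySolver.Downfold`; companion of
`TppSeamFilling.lean` (the `t''` seam at fixed filling — same (T1) shape) and of the tree's
`Literature/…/LayeredLatticeEnergyTransport.lean` (`tiGroundEnergyDensityAt_layeredHubbardTTPrime_mem_Icc_of_window`:
for `U ≥ 0`, `0 < n < 2`, any interlayer vectors `w_b` with `(w_b)₀ ≠ 0` and amplitudes `tz_b`, a 2D window
`lo ≤ energyDensityTT' t t' U n ≤ hi` is the window `[lo − 2Σ_b|tz_b|, hi]` for the fixed-filling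
translation-invariant ground-state energy density of the layered crystal
`layeredHubbardTTPrime t t' U w tz` on `ℤ³`) and `PeriodicLayeredLatticeEnergyTransport.lean` (bilayer crystals).

* `holdsOn_layeredHubbardTTPrime_of_window` — THE SEAM: a box `B` with entries `eU, eS, eN, eZ` for
  `U/t`, `tp/t`, `n`, `tperp/t` (`eU.lo ≥ 0`, `0 < eN.lo`, `eN.hi < 2`) and an S2 statement
  `∀ θ ∈ Set.Icc (s2Lo eU eS eN) (s2Hi eU eS eN), L ≤ energyDensityTT' 1 (θ 1) (θ 0) (θ 2) ≤ R` (EXACTLY the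
  `_word_Icc` shape) give, ON `B`, for EVERY interlayer pattern (vectors `w_b`, `(w_b)₀ ≠ 0`, in the range box
  `R' ≥ 1`) whose amplitudes satisfy `Σ_b |tz_b| ≤ |p tperpOverT|`:
  `L − 2·mZ ≤ e_{p n}(layered crystal) ≤ R`, `mZ = max |eZ.lo| |eZ.hi|` (floor inflation `2 mZ`, cap unchanged).
* `holdsOn_verticalHubbardTTPrime_of_window` — the simple-tetragonal instance (one vertical bond `(1,0,0)`
  with amplitude `p tperpOverT`): window `[L − 2 mZ, R]` for
  `(layeredHubbardTTPrime 1 (p tpOverT) (p UOverT) (fun _ : Fin 1 => e₀) (fun _ => p tperpOverT)).tiGroundEnergyDensityAt 1 (p n)`.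
* `holdsOn_bilayerHubbardTTPrime_of_window` — bilayer crystals (period 2; intra-bilayer `t⊥ = p tperpOverT`,
  inter-bilayer `t⊥'` with `|t⊥'| ≤ |t⊥|`): window `[L − 2 mZ, R]` for the variational cell energy over the
  period-2 periodic states of cell filling `p n` (allowance `|t⊥| + |t⊥'| ≤ 2 mZ`).

Everything here is PROVED. HONEST FRAMING: energy words only (fixed-filling translation-invariant /
periodic variational ground-state energy densities of the one-band crystal); a downfolded box is a systematic
modelling claim (hypothesis `B.Mem p`); where a record prints no `tperp/t` row the 2D word stays 2D (no entry,
no theorem); the interlayer constant is the norm row `2` per bond vector; nothing here bears on order, pairing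
or a phase word, and no number about any material is certified by this file.
-/

namespace Summit.Ventures.CertifiedManyBodySolver.Downfold

open NonemptyInterval Literature.MathematicalPhysics.QuantumLattice
  Literature.MathematicalPhysics.QuantumLattice.ThermodynamicLimit Literature.Probability.LatticeModels

/-- Reading the S2 window of a box member in the layered theorems' variables. [folklore] -/
theorem window_of_mem {B : OneBandBox} {eU eS eN : Entry} (hU : B .UOverT = some eU)
    (hS : B .tpOverT = some eS) (hN : B .filling = some eN) {L R : ℝ}
    (hE : ∀ θ ∈ Set.Icc (s2Lo eU eS eN) (s2Hi eU eS eN),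
      L ≤ energyDensityTT' 1 (θ 1) (θ 0) (θ 2) ∧ energyDensityTT' 1 (θ 1) (θ 0) (θ 2) ≤ R)
    {p : OneBandCoord → ℝ} (hp : B.Mem p) :
    L ≤ energyDensityTT' 1 (p .tpOverT) (p .UOverT) (p .filling) ∧
      energyDensityTT' 1 (p .tpOverT) (p .UOverT) (p .filling) ≤ R :=
  hE (s2Coords p) (s2Coords_mem_Icc hU hS hN hp)

/-- **THE INTERLAYER SEAM (object E/M window ⇒ layered-crystal window), every interlayer pattern.** Let `B`
carry entries `eU, eS, eN, eZ` for `U/t`, `tp/t`, `n`, `tperp/t` with `eU.lo ≥ 0`, `0 < eN.lo`, `eN.hi < 2`, and let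
the S2 word `L ≤ energyDensityTT' 1 (θ 1) (θ 0) (θ 2) ≤ R` hold on the delivered box. Then on `B`, for every family
of interlayer vectors `w_b` (`(w_b)₀ ≠ 0`, inside the range box `R' ≥ 1`) and amplitudes with `Σ_b |tz_b| ≤ |p tperp/t|`,
the layered crystal's fixed-filling ground-state energy density lies in `[L − 2·max(|eZ.lo|,|eZ.hi|), R]`.
[folklore] -/
theorem holdsOn_layeredHubbardTTPrime_of_window {B : OneBandBox} {eU eS eN eZ : Entry}
    (hU : B .UOverT = some eU) (hS : B .tpOverT = some eS) (hN : B .filling = some eN)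
    (hZ : B .tperpOverT = some eZ) (hU0 : 0 ≤ eU.encl.fst) (hN0 : 0 < eN.encl.fst) (hN2 : eN.encl.snd < 2)
    {L R : ℝ}
    (hE : ∀ θ ∈ Set.Icc (s2Lo eU eS eN) (s2Hi eU eS eN),
      L ≤ energyDensityTT' 1 (θ 1) (θ 0) (θ 2) ∧ energyDensityTT' 1 (θ 1) (θ 0) (θ 2) ≤ R)
    {κ : Type*} [Fintype κ] {w : κ → Site 3} (hw : ∀ b, w b 0 ≠ 0) {R' : ℝ} (hR' : 1 ≤ R')
    (hwR' : ∀ b, w b ∈ thicken ({0} : Finset (Site 3)) R') :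
    HoldsOn (fun p : OneBandCoord → ℝ => ∀ tz : κ → ℝ, ∑ b, |tz b| ≤ |p .tperpOverT| →
      L - 2 * ((max |eZ.encl.fst| |eZ.encl.snd| : ℚ) : ℝ) ≤
          (layeredHubbardTTPrime 1 (p .tpOverT) (p .UOverT) w tz).tiGroundEnergyDensityAt R' (p .filling) ∧
        (layeredHubbardTTPrime 1 (p .tpOverT) (p .UOverT) w tz).tiGroundEnergyDensityAt R' (p .filling) ≤ R) B := by
  intro p hp tz htz
  obtain ⟨hu0, hn0, hn2⟩ := mem_sideConditions hU hN hU0 hN0 hN2 hp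
  have hθ := window_of_mem hU hS hN hE hp
  have hm : |p .tperpOverT| ≤ ((max |eZ.encl.fst| |eZ.encl.snd| : ℚ) : ℝ) := Entry.abs_le_of_mem (hp _ _ hZ)
  have h := tiGroundEnergyDensityAt_layeredHubbardTTPrime_mem_Icc_of_window 1 (p .tpOverT) hu0 hn0 hn2 hw tz hR' hwR'
    hθ.1 hθ.2
  exact ⟨by linarith [h.1, htz.trans hm], h.2⟩

/-- The vertical unit vector of `ℤ³` has a nonzero layer component and lies in the unit range box. [folklore] -/
theorem unitVec_zero_vertical : (unitVec (0 : Fin 3) : Site 3) 0 ≠ 0 ∧ (unitVec (0 : Fin 3) : Site 3) ∈ thicken ({0} : Finset (Site 3)) 1 :=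
  ⟨unitVec_zero_apply_zero_ne_zero, unitVec_mem_thicken_one 0⟩

/-- **THE INTERLAYER SEAM, simple tetragonal stacking** (one vertical bond `(1,0,0)` of amplitude `p tperp/t`):
on `B`, `L − 2·max(|eZ.lo|,|eZ.hi|) ≤ e_{p n}(vertical crystal) ≤ R`. [folklore] -/
theorem holdsOn_verticalHubbardTTPrime_of_window {B : OneBandBox} {eU eS eN eZ : Entry}
    (hU : B .UOverT = some eU) (hS : B .tpOverT = some eS) (hN : B .filling = some eN)
    (hZ : B .tperpOverT = some eZ) (hU0 : 0 ≤ eU.encl.fst) (hN0 : 0 < eN.encl.fst) (hN2 : eN.encl.snd < 2)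
    {L R : ℝ}
    (hE : ∀ θ ∈ Set.Icc (s2Lo eU eS eN) (s2Hi eU eS eN),
      L ≤ energyDensityTT' 1 (θ 1) (θ 0) (θ 2) ∧ energyDensityTT' 1 (θ 1) (θ 0) (θ 2) ≤ R) :
    HoldsOn (fun p : OneBandCoord → ℝ =>
      L - 2 * ((max |eZ.encl.fst| |eZ.encl.snd| : ℚ) : ℝ) ≤
          (layeredHubbardTTPrime 1 (p .tpOverT) (p .UOverT) (fun _ : Fin 1 => (unitVec (0 : Fin 3) : Site 3))
            (fun _ => p .tperpOverT)).tiGroundEnergyDensityAt 1 (p .filling) ∧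
        (layeredHubbardTTPrime 1 (p .tpOverT) (p .UOverT) (fun _ : Fin 1 => (unitVec (0 : Fin 3) : Site 3))
            (fun _ => p .tperpOverT)).tiGroundEnergyDensityAt 1 (p .filling) ≤ R) B := by
  intro p hp
  have h := holdsOn_layeredHubbardTTPrime_of_window hU hS hN hZ hU0 hN0 hN2 hE
    (w := fun _ : Fin 1 => (unitVec (0 : Fin 3) : Site 3)) (fun _ => unitVec_zero_vertical.1) le_rfl
    (fun _ => unitVec_zero_vertical.2) p hp (fun _ => p .tperpOverT) (by simp)
  exact h

/-- **THE INTERLAYER SEAM, bilayer crystals** (stacking period `2`, vertical bonds: intra-bilayer amplitude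
`p tperp/t` from even layers, inter-bilayer `t⊥'` from odd layers with `|t⊥'| ≤ |p tperp/t|`): on `B`, the
variational cell energy of the bilayer crystal over the period-`2` periodic states of cell filling `p n` lies in
`[L − 2·max(|eZ.lo|,|eZ.hi|), R]` (allowance `|t⊥| + |t⊥'| ≤ 2·mZ`). [folklore] -/
theorem holdsOn_bilayerHubbardTTPrime_of_window {B : OneBandBox} {eU eS eN eZ : Entry}
    (hU : B .UOverT = some eU) (hS : B .tpOverT = some eS) (hN : B .filling = some eN)
    (hZ : B .tperpOverT = some eZ) (hU0 : 0 ≤ eU.encl.fst) (hN0 : 0 < eN.encl.fst) (hN2 : eN.encl.snd < 2)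
    {L R : ℝ}
    (hE : ∀ θ ∈ Set.Icc (s2Lo eU eS eN) (s2Hi eU eS eN),
      L ≤ energyDensityTT' 1 (θ 1) (θ 0) (θ 2) ∧ energyDensityTT' 1 (θ 1) (θ 0) (θ 2) ≤ R) :
    HoldsOn (fun p : OneBandCoord → ℝ => ∀ tperp' : ℝ, |tperp'| ≤ |p .tperpOverT| →
      L - 2 * ((max |eZ.encl.fst| |eZ.encl.snd| : ℚ) : ℝ) ≤
          infCellEnergyOn (periodicStatesAt (stackPeriods 2 1) (p .filling))
            (periodicLayeredHubbardTTPrimeViews 1 1 (p .tpOverT) (p .UOverT)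
              (fun _ : Fin 1 => (unitVec (0 : Fin 3) : Site 3)) fun j _ => ![p .tperpOverT, tperp'] j) 1 ∧
        infCellEnergyOn (periodicStatesAt (stackPeriods 2 1) (p .filling))
            (periodicLayeredHubbardTTPrimeViews 1 1 (p .tpOverT) (p .UOverT)
              (fun _ : Fin 1 => (unitVec (0 : Fin 3) : Site 3)) fun j _ => ![p .tperpOverT, tperp'] j) 1 ≤ R) B := by
  intro p hp tperp' htp
  obtain ⟨hu0, hn0, hn2⟩ := mem_sideConditions hU hN hU0 hN0 hN2 hp
  have hθ := window_of_mem hU hS hN hE hp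
  have hm : |p .tperpOverT| ≤ ((max |eZ.encl.fst| |eZ.encl.snd| : ℚ) : ℝ) := Entry.abs_le_of_mem (hp _ _ hZ)
  have h := infCellEnergyOn_bilayerHubbardTTPrime_mem_Icc 1 (p .tpOverT) hu0 hn0 hn2 (p .tperpOverT) tperp'
  exact ⟨by linarith [h.1, hθ.1], h.2.trans hθ.2⟩

end Summit.Ventures.CertifiedManyBodySolver.Downfold
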